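import Summits.HodgeConjecture.HodgeConjecture.Theorems.MarkmanPartnerTransportLatticeBridgeHodge

/-!
# Route MarkmanPartnerTransport · lattice bridge, III: Hodge endomorphisms of `ℚ^ι` versus `End_Hdg(T)`
# (generic index type)

Generic-index version of `Theorems/AnchorTransportAnchorExistenceK3SquareCMFloorSpan` for a period datum
`D` on `ℚ^ι` (`…LatticeBridgeHodge`): irreducibility of the transcendental Hodge structure `D.hodgeT`
(Huybrechts, Ch. 3 Lemma 3.1); a rational endomorphism `φ` of `ℚ^ι` whose complexification has the
period as an eigenvector and preserves `{x, x̄}^⊥` preserves `N` and `T = N^⊥` (Riesz vector), and its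
restriction to `T` lies in `End_Hdg(T)` (`restrict_mem_endAlg`); conversely an element of `End_Hdg(T)`
extended by the identity of `N` (`extendT`) complexifies to an endomorphism with the period as eigenvector
preserving `{x, x̄}^⊥` (`cxEnd_extendT_period`, `BC_cxEnd_extendT`). This is the two-way dictionary
between "rational Hodge endomorphisms of `H²`" in a marking and the endomorphism field `E = End_Hdg(T)` of
Zarhin's theorems. Consumer: the `X`-side one-cycle theorem of crux #5 (`…K3Sq2OneCycle`). Pure linear
algebra; no named fact, no sorry. Prover seat hodge-nonav-19652-p1 (gen 8), `--supports stmt-HodgeConjecture-19653`.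

References: D. Huybrechts, *Lectures on K3 Surfaces*, Ch. 3 Lemma 3.2.7, Lemma 3.3.1, §3.3.3 Cor. 3.3.6,
§3.3.5 Lemma 3.3.12.
-/

noncomputable section

set_option linter.dupNamespace false

open scoped TensorProduct
open Module
open Literature.AlgebraicGeometry.Motives Literature.AlgebraicGeometry.Motives.HodgeStructure
open Summit.HodgeConjecture.HodgeConjecture.Theorems.NikulinTwinTransport

namespace Summit.HodgeConjecture.HodgeConjecture.Theorems.MarkmanPartnerTransport.LatticeBridge

namespace PeriodDatum

variable {ι : Type*} [Fintype ι] [DecidableEq ι] (D : PeriodDatum ι)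

/-! ### Irreducibility (Huybrechts, Ch. 3 Lemma 3.1) -/

/-- For a subspace `S ≤ T`, `ι_T (S_ℂ)` lies in the complex span of `S`. [folklore] -/
theorem iota_baseChange_subtype_mem_span (S : Submodule ℚ D.T) (w : ℂ ⊗[ℚ] S) :
    iota D.T (S.subtype.baseChange ℂ w) ∈
      Submodule.span ℂ (Set.range fun s : S => fun i => (((s : D.T) : ι → ℚ) i : ℂ)) := by
  induction w using TensorProduct.induction_on with
  | zero => rw [map_zero, map_zero]; exact Submodule.zero_mem _
  | tmul c s =>
    rw [LinearMap.baseChange_tmul, iota_tmul]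
    exact Submodule.smul_mem _ _ (Submodule.subset_span ⟨s, rfl⟩)
  | add a b ha hb => rw [map_add, map_add]; exact Submodule.add_mem _ ha hb

/-- A rational vector orthogonal over `ℚ` to `S` is orthogonal over `ℂ` to the complex span of `S`.
[folklore] -/
theorem BC_eq_zero_of_mem_span (S : Submodule ℚ D.T) {t : ι → ℚ} (ht : ∀ s : S, D.B t ((s : D.T) : ι → ℚ) = 0)
    {z : ι → ℂ} (hz : z ∈ Submodule.span ℂ (Set.range fun s : S => fun i => (((s : D.T) : ι → ℚ) i : ℂ))) :
    D.BC (fun i => (t i : ℂ)) z = 0 := by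
  induction hz using Submodule.span_induction with
  | mem z hz =>
    obtain ⟨s, rfl⟩ := hz
    rw [D.ratCast_form, ht s, Rat.cast_zero]
  | zero => exact LinearMap.BilinForm.zero_right _
  | add a b _ _ ha hb => rw [LinearMap.BilinForm.add_right, ha, hb, add_zero]
  | smul c z _ h => rw [LinearMap.BilinForm.smul_right, h, mul_zero]

/-- **Huybrechts, Ch. 3 Lemma 3.1: the transcendental Hodge structure is irreducible.** For a sub-Hodge
structure `S ≤ T`: if `ω ∈ S_ℂ` then every `t ∈ T` orthogonal to `S` is orthogonal to `x`, hence `0`, so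
`S = T` by non-degeneracy; if `ω ∉ S_ℂ` then `S_ℂ ∩ F² = 0`, so `S_ℂ ⊆ x̄^⊥`, every `s ∈ S` is orthogonal
to `x`, `S = 0`. [cite: Huybrechts2016K3, Ch. 3 Lemma 3.3.1 and Lemma 3.2.7] -/
theorem isIrreducible_hodgeT : D.hodgeT.IsIrreducible := by
  refine ⟨?_, fun W => ?_⟩
  · rw [Submodule.nontrivial_iff_ne_bot]
    intro hbot
    apply D.omega_ne_zero
    have hall : ∀ z : ℂ ⊗[ℚ] D.T, z = 0 := fun z => by
      induction z using TensorProduct.induction_on with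
      | zero => rfl
      | tmul c t =>
        have ht : t = 0 := by
          apply Subtype.ext
          rw [Submodule.coe_zero]
          exact (Submodule.mem_bot ℚ).1 (hbot.le t.2)
        rw [ht, TensorProduct.tmul_zero]
      | add a b ha hb => rw [ha, hb, add_zero]
    exact hall _
  · set S := W.toSubmodule with hS
    have hj : Function.Injective (S.subtype.baseChange ℂ) := by
      rw [LinearMap.baseChange_eq_ltensor]
      exact Module.Flat.lTensor_preserves_injective_linearMap _ S.injective_subtype
    by_cases hω : D.omega ∈ LinearMap.range (S.subtype.baseChange ℂ)
    · -- `ω ∈ S_ℂ`: then `S = T`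
      right
      obtain ⟨w, hw⟩ := hω
      have hxspan : D.x ∈ Submodule.span ℂ (Set.range fun s : S => fun i => (((s : D.T) : ι → ℚ) i : ℂ)) := by
        rw [← D.iota_omega, ← hw]
        exact D.iota_baseChange_subtype_mem_span S w
      have horth : (D.B.restrict D.T).orthogonal S = ⊥ := by
        rw [eq_bot_iff]
        intro t ht
        rw [LinearMap.BilinForm.mem_orthogonal_iff] at ht
        have ht' : ∀ s : S, D.B (t : ι → ℚ) ((s : D.T) : ι → ℚ) = 0 := fun s => by
          have h := ht s s.2
          rw [LinearMap.BilinForm.restrict_apply, LinearMap.domRestrict_apply] at h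
          rw [D.B_comm]
          exact h
        have h1 : D.BC (fun i => ((t : ι → ℚ) i : ℂ)) D.x = 0 := D.BC_eq_zero_of_mem_span S ht' hxspan
        have ht0 : (t : ι → ℚ) = 0 := D.eq_zero_of_mem_T t.2 h1
        rw [Submodule.mem_bot]
        exact Subtype.ext ht0
      have hfin := LinearMap.BilinForm.finrank_orthogonal D.restrict_nondegenerate S
      rw [horth, finrank_bot] at hfin
      have hle := Submodule.finrank_le S
      exact Submodule.eq_top_of_finrank_eq (by omega)
    · -- `ω ∉ S_ℂ`: then `S = 0`
      left
      have hF2 : (D.hodgeT.F 2).comap (S.subtype.baseChange ℂ) = ⊥ := by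
        rw [eq_bot_iff]
        intro w hw
        rw [Submodule.mem_comap] at hw
        change S.subtype.baseChange ℂ w ∈ periodF (D.B.restrict D.T) D.omega 2 at hw
        rw [mem_periodF_two] at hw
        obtain ⟨c, hc⟩ := hw
        by_cases hc0 : c = 0
        · rw [hc0, zero_smul] at hc
          rw [Submodule.mem_bot]
          exact hj (by rw [← hc, map_zero])
        · exfalso
          apply hω
          refine ⟨c⁻¹ • w, ?_⟩
          rw [map_smul, ← hc, smul_smul, inv_mul_cancel₀ hc0, one_smul]
      have htop : (complexConj (D.hodgeT.F 1)).comap (S.subtype.baseChange ℂ) = ⊤ := by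
        have h := (W.isCompl 2 1 (by norm_num)).sup_eq_top
        rwa [← hS, hF2, bot_sup_eq] at h
      rw [eq_bot_iff]
      intro s hs
      have hmem : (1 : ℂ) ⊗ₜ[ℚ] (⟨s, hs⟩ : S) ∈ (complexConj (D.hodgeT.F 1)).comap (S.subtype.baseChange ℂ) := by
        rw [htop]; exact Submodule.mem_top
      rw [Submodule.mem_comap, LinearMap.baseChange_tmul, Submodule.subtype_apply] at hmem
      change (1 : ℂ) ⊗ₜ[ℚ] s ∈ complexConj (periodF (D.B.restrict D.T) D.omega 1) at hmem
      rw [mem_complexConj_periodF_one, restrict_baseChange_apply D.T D.ratCast_form, D.iota_conj_omega, iota_one_tmul,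
        D.BC_comm] at hmem
      have h1 : D.BC (fun i => ((s : ι → ℚ) i : ℂ)) D.x = 0 := (D.ratCast_period_eq_zero_iff _).1 hmem
      have hs0 : (s : ι → ℚ) = 0 := D.eq_zero_of_mem_T s.2 h1
      rw [Submodule.mem_bot]
      exact Subtype.ext hs0

/-! ### Extending endomorphisms of `T` by the identity of `N` -/

/-- **`û = u ⊕ id_N`**: the extension of an endomorphism `u` of `T` to `ℚ^ι = N ⊕ T` by the identity on
`N`. [cite: Huybrechts2016K3, Ch. 3 Lemma 3.3.1] -/
def extendT (u : Module.End ℚ D.T) : Module.End ℚ (ι → ℚ) :=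
  D.T.subtype ∘ₗ u ∘ₗ D.T.projectionOnto D.N D.isCompl.symm + D.N.projection _ D.isCompl

/-- `û v = u (pr_T v) + pr_N v`. [folklore] -/
theorem extendT_apply (u : Module.End ℚ D.T) (v : ι → ℚ) :
    D.extendT u v = (u (D.T.projectionOnto D.N D.isCompl.symm v) : ι → ℚ) + D.N.projection _ D.isCompl v := rfl

/-- `û t = u t` on `T`. [folklore] -/
theorem extendT_apply_coe (u : Module.End ℚ D.T) (t : D.T) : D.extendT u t = u t := by
  rw [extendT_apply, Submodule.projectionOnto_apply_left, Submodule.projection_apply_right, add_zero]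

/-- `û n = n` on `N`. [folklore] -/
theorem extendT_apply_of_mem (u : Module.End ℚ D.T) {n : ι → ℚ} (hn : n ∈ D.N) : D.extendT u n = n := by
  rw [extendT_apply, Submodule.projectionOnto_apply_of_mem_right _ hn, map_zero, Submodule.coe_zero, zero_add,
    Submodule.projection_apply_of_mem_left _ hn]

/-- `û ∘ pr_N = pr_N`. [folklore] -/
theorem extendT_comp_projection (u : Module.End ℚ D.T) :
    D.extendT u ∘ₗ D.N.projection _ D.isCompl = D.N.projection _ D.isCompl :=
  LinearMap.ext fun v => D.extendT_apply_of_mem u (Submodule.projection_apply_mem _ v)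

/-- **`ι_T ∘ u_ℂ = û_ℂ ∘ ι_T`.** [folklore] -/
theorem iota_baseChange (u : Module.End ℚ D.T) (z : ℂ ⊗[ℚ] D.T) :
    iota _ (u.baseChange ℂ z) = cxEnd (D.extendT u) (iota _ z) := by
  induction z using TensorProduct.induction_on with
  | zero => rw [map_zero, map_zero, map_zero]
  | tmul c t => rw [LinearMap.baseChange_tmul, iota_tmul, iota_tmul, map_smul, cxEnd_ratVec, extendT_apply_coe]
  | add a b ha hb => rw [map_add, map_add, map_add, map_add, ha, hb]

/-- **The extension by the identity of an isometry of `T` is an isometry of `ℚ^ι`** (`N ⊥ T`).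
[cite: Huybrechts2016K3, Ch. 3 Lemma 3.3.1] -/
theorem B_extendT (u : Module.End ℚ D.T) (hu : ∀ a b : D.T, D.B (u a) (u b) = D.B a b) (v w : ι → ℚ) :
    D.B (D.extendT u v) (D.extendT u w) = D.B v w := by
  set P := D.N.projection _ D.isCompl with hP
  set Q' := D.T.projectionOnto D.N D.isCompl.symm with hQ'
  have orth : ∀ n : ι → ℚ, n ∈ D.N → ∀ t : D.T, D.B n t = 0 ∧ D.B (t : ι → ℚ) n = 0 :=
    fun n hn t => D.B_eq_zero_of_mem hn t.2
  have hv : v = (Q' v : ι → ℚ) + P v := by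
    rw [hQ', Submodule.coe_projectionOnto_apply, add_comm]
    exact (Submodule.projection_add_projection_eq_self D.isCompl v).symm
  have hw : w = (Q' w : ι → ℚ) + P w := by
    rw [hQ', Submodule.coe_projectionOnto_apply, add_comm]
    exact (Submodule.projection_add_projection_eq_self D.isCompl w).symm
  have hPv : P v ∈ D.N := Submodule.projection_apply_mem D.isCompl v
  have hPw : P w ∈ D.N := Submodule.projection_apply_mem D.isCompl w
  rw [extendT_apply, extendT_apply, ← hP, ← hQ']
  conv_rhs => rw [hv, hw]
  simp only [map_add, LinearMap.add_apply, (orth _ hPv _).1, (orth _ hPw _).2, hu, add_zero, zero_add]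

/-! ### Hodge endomorphisms of `ℚ^ι` and `End_Hdg(T)` -/

/-- **A Hodge endomorphism of `ℚ^ι` preserves `N`** (`N` = the rational vectors of type `(1,1)`).
[cite: Huybrechts2016K3, Ch. 3 Lemma 3.3.1] -/
theorem map_mem_N (φ : Module.End ℚ (ι → ℚ))
    (hφ11 : ∀ z : ι → ℂ, D.BC z D.x = 0 → D.BC z (star D.x) = 0 →
      D.BC (cxEnd φ z) D.x = 0 ∧ D.BC (cxEnd φ z) (star D.x) = 0)
    {n : ι → ℚ} (hn : n ∈ D.N) : φ n ∈ D.N := by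
  rw [D.mem_N_iff] at hn ⊢
  have h := hφ11 _ hn.1 hn.2
  rwa [cxEnd_ratVec] at h

/-- The complexification of a Hodge endomorphism has `x̄` as an eigenvector too. [folklore] -/
theorem cxEnd_star_period {φ : Module.End ℚ (ι → ℚ)} (hφx : ∃ c : ℂ, cxEnd φ D.x = c • D.x) :
    ∃ c : ℂ, cxEnd φ (star D.x) = c • star D.x := by
  obtain ⟨c, hc⟩ := hφx
  exact ⟨star c, by rw [cxEnd_star, hc, star_smul]⟩

/-- **A Hodge endomorphism of `ℚ^ι` preserves `T = N^⊥`**: the Riesz vector `w` of `v ↦ (φ v.n)` (`n ∈ N`)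
is again a rational `(1,1)`-vector, so `(φ t.n) = (t.w) = 0` for `t ∈ T`.
[cite: Huybrechts2016K3, Ch. 3 Lemma 3.3.1 and §3.3.5 Lemma 3.3.12] -/
theorem map_mem_T (φ : Module.End ℚ (ι → ℚ)) (hφx : ∃ c : ℂ, cxEnd φ D.x = c • D.x)
    {t : ι → ℚ} (ht : t ∈ D.T) : φ t ∈ D.T := by
  rw [D.mem_T_iff]
  intro n hn
  -- the Riesz vector `w` with `B(φ v, n) = B(v, w)`
  set w := (D.B.toDual D.nondegenerate).symm ((D.B n) ∘ₗ φ) with hwdef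
  have hw : ∀ v, D.B (φ v) n = D.B v w := fun v => by
    rw [D.B_comm (φ v) n, hwdef, D.B_comm v, LinearMap.BilinForm.apply_toDual_symm_apply]
    rfl
  have hwC : ∀ z : ι → ℂ, D.BC (cxEnd φ z) (fun i => (n i : ℂ)) = D.BC z (fun i => (w i : ℂ)) := by
    intro z
    have hlin : (D.BC.flip (fun i => (n i : ℂ))) ∘ₗ cxEnd φ = D.BC.flip (fun i => (w i : ℂ)) := by
      refine eq_of_forall_ratVec fun v => ?_
      rw [LinearMap.comp_apply, cxEnd_ratVec, LinearMap.BilinForm.flip_apply, LinearMap.BilinForm.flip_apply,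
        D.ratCast_form, D.ratCast_form, hw v]
    have h := LinearMap.congr_fun hlin z
    simpa only [LinearMap.comp_apply, LinearMap.BilinForm.flip_apply] using h
  -- `w` is a rational `(1,1)`-vector
  have hwN : w ∈ D.N := by
    obtain ⟨c', hc'⟩ := D.cxEnd_star_period hφx
    obtain ⟨c, hc⟩ := hφx
    obtain ⟨hnx, hnx'⟩ := D.BC_period_of_mem hn
    rw [D.mem_N_iff]
    constructor
    · rw [D.BC_comm, ← hwC D.x, hc, LinearMap.BilinForm.smul_left, hnx, mul_zero]
    · rw [D.BC_comm, ← hwC (star D.x), hc', LinearMap.BilinForm.smul_left, hnx', mul_zero]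
  rw [D.B_comm n (φ t), hw t, D.B_comm t w]
  exact (D.B_eq_zero_of_mem hwN ht).1

/-- `ι_T ∘ (φ|_T)_ℂ = φ_ℂ ∘ ι_T`. [folklore] -/
theorem iota_baseChange_restrict (φ : Module.End ℚ (ι → ℚ)) (hφT : ∀ t ∈ D.T, φ t ∈ D.T) (z : ℂ ⊗[ℚ] D.T) :
    iota _ ((φ.restrict hφT).baseChange ℂ z) = cxEnd φ (iota _ z) := by
  induction z using TensorProduct.induction_on with
  | zero => rw [map_zero, map_zero, map_zero]
  | tmul c t => rw [LinearMap.baseChange_tmul, iota_tmul, iota_tmul, map_smul, cxEnd_ratVec, LinearMap.coe_restrict_apply]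
  | add a b ha hb => rw [map_add, map_add, map_add, map_add, ha, hb]

/-- **The restriction to `T` of a Hodge endomorphism of `ℚ^ι` is a Hodge endomorphism of `T`**
(`(φ|_T)_ℂ ω ∈ ℂ ω`, and `(φ|_T)_ℂ` preserves `ω^⊥ = ℂx ⊕ (x^⊥ ∩ x̄^⊥)`).
[cite: Huybrechts2016K3, Ch. 3 Lemma 3.3.1 and §3.3.3] -/
theorem restrict_mem_endAlg (φ : Module.End ℚ (ι → ℚ)) (hφT : ∀ t ∈ D.T, φ t ∈ D.T)
    (hφx : ∃ c : ℂ, cxEnd φ D.x = c • D.x)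
    (hφ11 : ∀ z : ι → ℂ, D.BC z D.x = 0 → D.BC z (star D.x) = 0 →
      D.BC (cxEnd φ z) D.x = 0 ∧ D.BC (cxEnd φ z) (star D.x) = 0) :
    φ.restrict hφT ∈ D.hodgeT.endAlg := by
  obtain ⟨c, hc⟩ := hφx
  have hω : (φ.restrict hφT).baseChange ℂ D.omega = c • D.omega := by
    apply iota_injective
    rw [iota_baseChange_restrict, D.iota_omega, map_smul, D.iota_omega, hc]
  obtain ⟨-, hne⟩ := D.BC_self_star_period
  intro p
  change (periodF (D.B.restrict D.T) D.omega p).map _ ≤ periodF (D.B.restrict D.T) D.omega p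
  by_cases hp0 : p ≤ 0
  · rw [periodF_of_le_zero _ _ hp0]; exact le_top
  by_cases hp1 : p = 1
  · subst hp1
    rw [Submodule.map_le_iff_le_comap]
    intro w hw
    rw [Submodule.mem_comap, mem_periodF_one, restrict_baseChange_apply D.T D.ratCast_form, D.iota_omega,
      iota_baseChange_restrict]
    rw [mem_periodF_one, restrict_baseChange_apply D.T D.ratCast_form, D.iota_omega] at hw
    set v := iota _ w with hv
    set a : ℂ := D.BC v (star D.x) / D.BC D.x (star D.x) with ha
    have h1 : D.BC (v - a • D.x) D.x = 0 := by
      rw [LinearMap.BilinForm.sub_left, LinearMap.BilinForm.smul_left, D.period_sq, mul_zero, sub_zero, D.BC_comm]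
      exact hw
    have h2 : D.BC (v - a • D.x) (star D.x) = 0 := by
      rw [LinearMap.BilinForm.sub_left, LinearMap.BilinForm.smul_left, ha, div_mul_cancel₀ _ hne, sub_self]
    obtain ⟨h3, -⟩ := hφ11 _ h1 h2
    have hsplit : cxEnd φ v = cxEnd φ (v - a • D.x) + a • cxEnd φ D.x := by rw [map_sub, map_smul]; abel
    rw [D.BC_comm, hsplit, LinearMap.BilinForm.add_left, h3, hc, LinearMap.BilinForm.smul_left,
      LinearMap.BilinForm.smul_left, D.period_sq, mul_zero, mul_zero, add_zero]
  by_cases hp2 : p = 2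
  · subst hp2
    rw [Submodule.map_le_iff_le_comap]
    intro w hw
    obtain ⟨d, rfl⟩ := (mem_periodF_two _ _).1 hw
    rw [Submodule.mem_comap, map_smul, hω, smul_smul, mem_periodF_two]
    exact ⟨d * c, rfl⟩
  · rw [periodF_of_three_le _ _ (by omega), Submodule.map_bot]

/-- **An element of `End_Hdg(T)` extended by the identity is a Hodge endomorphism of `ℚ^ι`, I**: `x` is
an eigenvector of `û_ℂ`. [cite: Huybrechts2016K3, Ch. 3 §3.3.3 Cor. 3.3.6] -/
theorem cxEnd_extendT_period {u : Module.End ℚ D.T} (hu : u ∈ D.hodgeT.endAlg) :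
    ∃ c : ℂ, cxEnd (D.extendT u) D.x = c • D.x := by
  obtain ⟨c, hc⟩ := exists_smul_eq_of_mem_endAlg_ofPeriod _ _ hu
  refine ⟨c, ?_⟩
  rw [← D.iota_omega, ← iota_baseChange, hc, map_smul]

/-- The complexified projection onto `N` takes values orthogonal to `x` and `x̄`. [folklore] -/
theorem BC_cxEnd_projection (z : ι → ℂ) :
    D.BC (cxEnd (D.N.projection _ D.isCompl) z) D.x = 0 ∧
      D.BC (cxEnd (D.N.projection _ D.isCompl) z) (star D.x) = 0 := by
  have hmem := cxEnd_projection_mem_span D.isCompl z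
  exact ⟨form_eq_zero_of_mem_span D.N (fun n hn => ((D.mem_N_iff n).1 hn).1) hmem,
    form_eq_zero_of_mem_span D.N (fun n hn => ((D.mem_N_iff n).1 hn).2) hmem⟩

/-- **An element of `End_Hdg(T)` extended by the identity is a Hodge endomorphism of `ℚ^ι`, II**: `û_ℂ`
preserves `{x, x̄}^⊥` (`= N_ℂ ⊕ T^{1,1}`: it is the identity on `N_ℂ`, and on `T_ℂ` it is `u_ℂ`, which
preserves `F¹ = ω^⊥` and its conjugate). [cite: Huybrechts2016K3, Ch. 3 Lemma 3.3.1 and §3.3.3] -/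
theorem BC_cxEnd_extendT {u : Module.End ℚ D.T} (hu : u ∈ D.hodgeT.endAlg) {z : ι → ℂ} (hzx : D.BC z D.x = 0)
    (hzx' : D.BC z (star D.x) = 0) :
    D.BC (cxEnd (D.extendT u) z) D.x = 0 ∧ D.BC (cxEnd (D.extendT u) z) (star D.x) = 0 := by
  have hc := D.isCompl
  have hz := cxEnd_projection_add_apply hc z
  obtain ⟨hPx, hPx'⟩ := D.BC_cxEnd_projection z
  -- `û_ℂ ∘ pr_{N,ℂ} = pr_{N,ℂ}`
  have h1 : cxEnd (D.extendT u) (cxEnd (D.N.projection _ hc) z) = cxEnd (D.N.projection _ hc) z := by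
    rw [← LinearMap.comp_apply, ← cxEnd_comp, extendT_comp_projection]
  -- `pr_{T,ℂ} z = ι_T (λ z)` is orthogonal to `x`, `x̄`
  have hQ : cxEnd (D.T.projection D.N hc.symm) z = iota _ (lam hc z) := (iota_lam hc z).symm
  have hQx : D.BC (cxEnd (D.T.projection D.N hc.symm) z) D.x = 0 := by
    have h := congrArg (fun w => D.BC w D.x) hz
    simp only [LinearMap.BilinForm.add_left, hPx, zero_add, hzx] at h
    exact h
  have hQx' : D.BC (cxEnd (D.T.projection D.N hc.symm) z) (star D.x) = 0 := by
    have h := congrArg (fun w => D.BC w (star D.x)) hz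
    simp only [LinearMap.BilinForm.add_left, hPx', zero_add, hzx'] at h
    exact h
  rw [hQ] at hQx hQx'
  -- `λ z ∈ F¹ ∩ conj F¹`, preserved by `u_ℂ`
  have hF1 : lam hc z ∈ periodF (D.B.restrict D.T) D.omega 1 := by
    rw [mem_periodF_one, restrict_baseChange_apply D.T D.ratCast_form, D.iota_omega, D.BC_comm]; exact hQx
  have hF1c : lam hc z ∈ complexConj (periodF (D.B.restrict D.T) D.omega 1) := by
    rw [mem_complexConj_periodF_one, restrict_baseChange_apply D.T D.ratCast_form, D.iota_conj_omega, D.BC_comm]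
    exact hQx'
  have hu1 : u.baseChange ℂ (lam hc z) ∈ periodF (D.B.restrict D.T) D.omega 1 := hu 1 ⟨_, hF1, rfl⟩
  have hu1c : u.baseChange ℂ (lam hc z) ∈ complexConj (periodF (D.B.restrict D.T) D.omega 1) := by
    rw [mem_complexConj, conj_baseChange]
    exact hu 1 ⟨_, mem_complexConj.1 hF1c, rfl⟩
  rw [mem_periodF_one, restrict_baseChange_apply D.T D.ratCast_form, D.iota_omega, iota_baseChange, D.BC_comm] at hu1
  rw [mem_complexConj_periodF_one, restrict_baseChange_apply D.T D.ratCast_form, D.iota_conj_omega, iota_baseChange,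
    D.BC_comm] at hu1c
  rw [← hz, map_add, h1, hQ]
  exact ⟨by rw [LinearMap.BilinForm.add_left, hPx, zero_add]; exact hu1,
    by rw [LinearMap.BilinForm.add_left, hPx', zero_add]; exact hu1c⟩

end PeriodDatum

end Summit.HodgeConjecture.HodgeConjecture.Theorems.MarkmanPartnerTransport.LatticeBridge

end
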